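import Summits.QuantumAdvantage.QuantumAdvantage.Theorems.NearExactIsExact.Negative.OneSidedFrame
import Summits.QuantumAdvantage.QuantumAdvantage.Theorems.NearExactIsExact.Negative.ReflectedPairIdentity

/-!
# `NearExactIsExact` (stmt-QuantumAdvantage-14043) — negative lemma THEOREM ON (gen 42):
  THEOREM OZ extended to the `E ≠ 0` cubes — sections twisted by the base coordinate `γ_{i₀}`

**Context.** THEOREM OZ (`Negative.OneSidedFrame.oneSided_frame_empty`) empties every frame
`π(u, w) = (γ u, B(u) ⊕ M(u) w)` of the last Maiorana–McFarland habitat of `NearExactIsExact` whose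
sections `t_a(u) = M(u)⁻¹ e_a` through `B u ⊕ e_a` are AFFINE — for the two-sided skew stratum
`{naff = 5, A = 0}` of BQ-11 that is exactly the cube `E = 0` (fibre matrix independent of the twisted
base coordinate `u_{i₀}`; DISPROOF.md §46.19, §47.3, §48.9 of the b2b cell). In the cubes `E ≠ 0`
(`M(u) = I ⊕ N(ū) ⊕ u_{i₀} E`, §47.5) two-sidedness gives `M(u)⁻¹ = M′(γ u)` with
`M′(x) = I ⊕ N′(x̄) ⊕ x_{i₀} E` (`E² = 0`, `E′ = E`), so the sections are
`t_a(u) = p_a(ū) ⊕ γ_{i₀}(u)·q_a` with `p_a` affine and `q_a = E e_a` constant: QUADRATIC, through the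
single twisted coordinate `γ_{i₀}(u) = u_{i₀} ⊕ g(ū)`. OZ's certificate then acquires exactly one
obstruction term per `a` with `q_a ≠ 0`, the top coefficient `ĝ ∧ β̂_a ∧ R̂_a` (`β_a = ∂_{i₀} B_a`),
and the translation half of two-sidedness (TS: `M′(x)·B(γ x)` quadratic) kills it: the `x_{i₀}`-part of degree 4
of row `r` of `M′(x)B(γx)` is `x_{i₀}·(ĝ ∧ (Eβ̂)_r)`, so TS forces `ĝ ∧ β̂_a = 0` for every `a` with
`E e_a ≠ 0` (E in square-zero normal form).

**THEOREM ON** (`oneSided_frameN_empty`). `γ` quadratic with `γ(u⁺) = γ(u⁻) ⊕ δ`; a Boolean `h` with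
`h(u⁺) = ¬h(u⁻)` (the twisted coordinate); `B` quadratic; `c₁, c₂` cubic; sections
`t_a(u) = p_a(u) ⊕ (h(u) ∧ q_a)` with `p_a` affine, `q_a` constant; HYPOTHESIS (TS-consequence)
`hgb : q_a ≠ 0 → deg(g · ∂_{i₀}B_a) ≤ 2` where `g := h(·⁻)`. Then the zero-section identity `h0` and
the section identities `hsec_a` are contradictory. With OZ this empties, census-free, the WHOLE
two-sided skew stratum `{naff = 5, A = 0}` of BQ-11 (cubes Z, N1, N2: a square-zero `E` on `𝔽₂⁵` has
rank `≤ 2`), re-proving LEMMA u₅-SPLIT's programme, the cube-N censuses and the `A = 0` part of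
THEOREM CENSUS-K's bookkeeping without computation; `oneSided_cubeN_empty` is the census normal form.

**Proof.** As in OZ: `Σ_u c₂(γu,Bu) = 1` (h0), and the unconditional `key_identity`
`Σ_u c₂(γu,Bu) = Σ_a Σ_u w_a·D_a`, `w_a = B_a(u) ⊕ B_a(u⁻) = u_{i₀}·β_a(u)`,
`D_a = c₂(γu,Bu) ⊕ c₂(γu,Bu⊕e_a) = c₁(u,0) ⊕ c₁(u,t_a u)` (h0, hsec). New step: pointwise
`c₁(u, p_a ⊕ (h ∧ q_a)) = A_a(u) ⊕ h(u)·R_a(u)` with `A_a = c₁(u,p_a u)` cubic and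
`R_a = c₁(u,p_a u) ⊕ c₁(u, p_a u ⊕ q_a)` of degree `≤ 2` (derivative of a cubic in a constant direction
along an affine section), and `h(u) = u_{i₀} ⊕ g(u)`; a five-atom Boolean identity splits
`w_a·D_a = u_{i₀}β_a·(c₁(u,0) ⊕ A_a) + u_{i₀}·β_a R_a + u_{i₀}·(gβ_a)R_a`, of degrees `≤ 5, 4, 5`
(the last by `hgb`, or identically `0` when `q_a = 0`), so `Σ_u w_a D_a = 0` for every `a` and `1 = 0`.
Numerical guard (folder `ozn/ozn_probe.py` on the censusN families of disprove-g39, E of rank 1 and 2):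
two-sided translations (`B ∈ ker TS`) satisfy `ĝ ∧ β̂_a = 0` in 40/40 samples and OZ's functional is a
valid certificate in 40/40; for random quadratic `B` it is valid in 3/40 — exactly the 3 samples with
`ĝ ∧ β̂_a = 0` — while its `c₂`-side (`key_identity`) and normalisation hold in 80/80.

HONEST FRAMING: the value here is a THEOREM (a kernel-checked negative lemma emptying a further
census-bound sub-family of the last Maiorana–McFarland habitat of `NearExactIsExact`), NOT summit
progress; the mixing type `A ≠ 0`, bases without a constant-derivative direction, `naff ≤ 4` frames
with sections of other shapes, the crux and the summit are untouched.
-/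

set_option linter.dupNamespace false -- D-0017: single-problem summit ⇒ `QuantumAdvantage.QuantumAdvantage` by design

namespace Summit.QuantumAdvantage.QuantumAdvantage.Theorems.NearExactIsExact.Negative.OneSidedFrameN

open Finset
open Literature.Computability.QuantumComplexity
open Literature.Computability.QuantumComplexity.BuzetChailloux (bxor)
open Summit.QuantumAdvantage.QuantumAdvantage.Theorems.CubicForrelation.NearExactIsExact
  (fc_isDegLeFun_comp fc_deg_bxor stub_derivDegree te_isDegLeFun_band)
open Summit.QuantumAdvantage.QuantumAdvantage.Theorems.NearExactIsExact.Negative.SkewProductCore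
open Summit.QuantumAdvantage.QuantumAdvantage.Theorems.NearExactIsExact.Negative.SkewProductResidual
open Summit.QuantumAdvantage.QuantumAdvantage.Theorems.NearExactIsExact.Negative.UntwistedSection
  (sum_ind_delta)
open Summit.QuantumAdvantage.QuantumAdvantage.Theorems.NearExactIsExact.Negative.OneSidedTaylor
open Summit.QuantumAdvantage.QuantumAdvantage.Theorems.NearExactIsExact.Negative.OneSidedFrame
  (eq_one_of_add_one key_identity)
open Summit.QuantumAdvantage.QuantumAdvantage.Theorems.NearExactIsExact.Negative.ReflectedPairIdentity
  (section_coord_deg)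

variable {r : ℕ}

/-- The five-atom Boolean bookkeeping of THEOREM ON:
`(i ∧ β)·(X ⊕ (i ⊕ g)·R) = (i ∧ β)·X + i·βR + i·(gβ)R` in `𝔽₂`. [folklore] -/
theorem bool_split5 : ∀ i β X g R : Bool, ind ((i && β) && (X ^^ ((i ^^ g) && R))) =
    ind ((i && β) && X) + ind (i && (β && R)) + ind (i && ((g && β) && R)) := by decide

/-- `∂_{i₀}` of a quadratic, pulled back along `u ↦ u⁺`, is affine:
`deg (B(u⁺) ⊕ B(u⁻)) ≤ 1`. [folklore] -/
theorem update_deriv_deg (i₀ : Fin 6) (B : (Fin 6 → Bool) → Bool) (hB : IsDegLeFun 2 B) :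
    IsDegLeFun 1 (fun u : Fin 6 → Bool =>
      B (Function.update u i₀ true) ^^ B (Function.update u i₀ false)) := by
  have hD : IsDegLeFun 1 (fun v => B v ^^ B (bxor v (fun i => decide (i = i₀)))) :=
    stub_derivDegree 6 1 B _ hB
  have e : (fun u : Fin 6 → Bool => B (Function.update u i₀ true) ^^
      B (Function.update u i₀ false)) = fun u => B (Function.update u i₀ true) ^^
        B (bxor (Function.update u i₀ true) (fun i => decide (i = i₀))) := by
    funext u; rw [update_true_bxor]
  rw [e]
  exact fc_isDegLeFun_comp hD (fun u => Function.update u i₀ true) (update_coord_deg i₀ true)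
    (by norm_num)

/-- **THEOREM ON (gen 42).** THEOREM OZ with sections twisted through one base coordinate:
`t_a(u) = p_a(u) ⊕ (h(u) ∧ q_a)`, `p_a` affine, `q_a` constant, `h(u⁺) = ¬ h(u⁻)`, under the
TS-consequence `q_a ≠ 0 → deg(h(·⁻)·∂_{i₀}B_a) ≤ 2`: the zero-section identity and the `r` section
identities are contradictory, for every `r` (two-sided cubes N1/N2 of the skew stratum). [folklore] -/
theorem oneSided_frameN_empty (i₀ : Fin 6) (δ : Fin 6 → Bool)
    (γ : (Fin 6 → Bool) → (Fin 6 → Bool)) (hγq : ∀ i, IsDegLeFun 2 (fun u => γ u i))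
    (hγδ : ∀ u, γ (Function.update u i₀ true) = bxor (γ (Function.update u i₀ false)) δ)
    (h : (Fin 6 → Bool) → Bool)
    (hh : ∀ u, h (Function.update u i₀ true) = !h (Function.update u i₀ false))
    (B : Fin r → (Fin 6 → Bool) → Bool) (hB : ∀ k, IsDegLeFun 2 (B k))
    (c₁ c₂ : (Fin (6 + r) → Bool) → Bool) (h₁ : IsDegLeFun 3 c₁) (h₂ : IsDegLeFun 3 c₂)
    (p : Fin r → (Fin 6 → Bool) → Fin r → Bool) (hp : ∀ a k, IsDegLeFun 1 (fun u => p a u k))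
    (q : Fin r → Fin r → Bool)
    (hgb : ∀ a, (∃ k, q a k = true) → IsDegLeFun 2 (fun u : Fin 6 → Bool =>
      h (Function.update u i₀ false) &&
        (B a (Function.update u i₀ true) ^^ B a (Function.update u i₀ false))))
    (h0 : ∀ u, (c₁ (Fin.append u (fun _ => false)) ^^ c₂ (Fin.append (γ u) (fun k => B k u))) =
      decide (∀ i, u i = false))
    (hsec : ∀ a u, (c₁ (Fin.append u (fun k => p a u k ^^ (h u && q a k))) ^^
      c₂ (Fin.append (γ u) (fun k => decide (k = a) ^^ B k u))) = decide (∀ i, u i = false)) :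
    False := by
  -- (i) the zero-section term has odd weight
  have h1 : ∑ u : Fin 6 → Bool, ind (c₂ (Fin.append (γ u) (fun k => B k u))) = 1 := by
    have hc0 : IsDegLeFun 3 (fun u : Fin 6 → Bool => c₁ (Fin.append u (fun _ => false))) :=
      fc_isDegLeFun_comp h₁ (emb r) (emb_coord_deg r) (by norm_num)
    have hz := sum_ind_eq_zero_of_deg_five (hc0.mono (by norm_num))
    have aux : ∀ p q d : Bool, (p ^^ q) = d → (q ^^ d) = p := by decide
    have hpt : ∀ u : Fin 6 → Bool, ind (c₁ (Fin.append u (fun _ => false))) =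
        ind (c₂ (Fin.append (γ u) (fun k => B k u))) + ind (decide (∀ i, u i = false)) := fun u => by
      rw [← ind_xor, aux _ _ _ (h0 u)]
    rw [sum_congr rfl (fun u _ => hpt u), sum_add_distrib, sum_ind_delta] at hz
    exact eq_one_of_add_one _ hz
  -- (ii) each weighted section derivative has even weight — the new part
  have h2 : ∀ a, ∑ u : Fin 6 → Bool, ind ((B a u ^^ B a (Function.update u i₀ false)) &&
      (c₂ (Fin.append (γ u) (fun k => B k u)) ^^
        c₂ (Fin.append (γ u) (fun k => decide (k = a) ^^ B k u)))) = 0 := by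
    intro a
    -- the derivative `R_a` of `c₁` in the constant fibre direction `q_a` along the affine section `p_a`
    have hsc := section_coord_deg (p a) (hp a)
    have hA : IsDegLeFun 3 (fun u : Fin 6 → Bool => c₁ (Fin.append u (p a u))) :=
      fc_isDegLeFun_comp h₁ (fun u => Fin.append u (p a u)) hsc (by norm_num)
    have hR : IsDegLeFun 2 (fun u : Fin 6 → Bool => c₁ (Fin.append u (p a u)) ^^
        c₁ (bxor (Fin.append u (p a u)) (Fin.append (fun _ : Fin 6 => false) (q a)))) :=
      fc_isDegLeFun_comp (stub_derivDegree (6 + r) 2 c₁ (Fin.append (fun _ : Fin 6 => false) (q a)) h₁)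
        (fun u => Fin.append u (p a u)) hsc (by norm_num)
    have hc0 : IsDegLeFun 3 (fun u : Fin 6 → Bool => c₁ (Fin.append u (fun _ => false))) :=
      fc_isDegLeFun_comp h₁ (emb r) (emb_coord_deg r) (by norm_num)
    have hβ := update_deriv_deg i₀ (B a) (hB a)
    -- pointwise rewriting of the summand into the three families
    have aux2 : ∀ p q p' q' d : Bool, (p ^^ q) = d → (p' ^^ q') = d → (q ^^ q') = (p ^^ p') := by
      decide
    have hpt : ∀ u : Fin 6 → Bool, ind ((B a u ^^ B a (Function.update u i₀ false)) &&
        (c₂ (Fin.append (γ u) (fun k => B k u)) ^^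
          c₂ (Fin.append (γ u) (fun k => decide (k = a) ^^ B k u)))) =
        ind ((u i₀ && (B a (Function.update u i₀ true) ^^ B a (Function.update u i₀ false))) &&
            (c₁ (Fin.append u (fun _ => false)) ^^ c₁ (Fin.append u (p a u)))) +
          ind (u i₀ && ((B a (Function.update u i₀ true) ^^ B a (Function.update u i₀ false)) &&
            (c₁ (Fin.append u (p a u)) ^^
              c₁ (bxor (Fin.append u (p a u)) (Fin.append (fun _ : Fin 6 => false) (q a)))))) +
          ind (u i₀ && (((h (Function.update u i₀ false)) &&
            (B a (Function.update u i₀ true) ^^ B a (Function.update u i₀ false))) &&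
            (c₁ (Fin.append u (p a u)) ^^
              c₁ (bxor (Fin.append u (p a u)) (Fin.append (fun _ : Fin 6 => false) (q a)))))) := by
      intro u
      have hq : bxor (Fin.append u (p a u)) (Fin.append (fun _ : Fin 6 => false) (q a)) =
          Fin.append u (fun k => p a u k ^^ q a k) := by
        rw [bxor_append_blocks, bxor_zero_right]
      rw [aux2 _ _ _ _ _ (h0 u) (hsec a u), ← bool_split5, hq]
      -- `w_a u = u_{i₀} ∧ β_a u`, `h u = u_{i₀} ⊕ h u⁻`, `c₁(u,t_a u) = A ⊕ h·R`
      have F1 : (B a u ^^ B a (Function.update u i₀ false)) =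
          (u i₀ && (B a (Function.update u i₀ true) ^^ B a (Function.update u i₀ false))) := by
        cases hi : u i₀
        · rw [show Function.update u i₀ false = u by rw [← hi, Function.update_eq_self]]; simp
        · rw [show Function.update u i₀ true = u by rw [← hi, Function.update_eq_self]]; simp
      have F2 : h u = (u i₀ ^^ h (Function.update u i₀ false)) := by
        cases hi : u i₀
        · rw [show Function.update u i₀ false = u by rw [← hi, Function.update_eq_self]]; simp
        · rw [Bool.true_xor, ← hh u,
            show Function.update u i₀ true = u by rw [← hi, Function.update_eq_self]]
      have F3 : c₁ (Fin.append u (fun k => p a u k ^^ (h u && q a k))) =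
          (c₁ (Fin.append u (p a u)) ^^ (h u &&
            (c₁ (Fin.append u (p a u)) ^^ c₁ (Fin.append u (fun k => p a u k ^^ q a k))))) := by
        cases h u
        · simp
        · cases c₁ (Fin.append u (p a u)) <;> simp
      rw [F3, F1, F2]
      simp only [Bool.xor_assoc]
    rw [sum_congr rfl (fun u _ => hpt u), sum_add_distrib, sum_add_distrib]
    have s1 : ∑ u : Fin 6 → Bool,
        ind ((u i₀ && (B a (Function.update u i₀ true) ^^ B a (Function.update u i₀ false))) &&
          (c₁ (Fin.append u (fun _ => false)) ^^ c₁ (Fin.append u (p a u)))) = 0 :=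
      sum_ind_eq_zero_of_deg_five
        (te_isDegLeFun_band (te_isDegLeFun_band (isDegLeFun_apply i₀ le_rfl) hβ) (fc_deg_bxor hc0 hA))
    have s2 : ∑ u : Fin 6 → Bool,
        ind (u i₀ && ((B a (Function.update u i₀ true) ^^ B a (Function.update u i₀ false)) &&
          (c₁ (Fin.append u (p a u)) ^^
            c₁ (bxor (Fin.append u (p a u)) (Fin.append (fun _ : Fin 6 => false) (q a)))))) = 0 :=
      sum_ind_eq_zero_of_deg_five
        ((te_isDegLeFun_band (isDegLeFun_apply i₀ le_rfl) (te_isDegLeFun_band hβ hR)).mono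
          (by norm_num))
    have s3 : ∑ u : Fin 6 → Bool,
        ind (u i₀ && (((h (Function.update u i₀ false)) &&
          (B a (Function.update u i₀ true) ^^ B a (Function.update u i₀ false))) &&
          (c₁ (Fin.append u (p a u)) ^^
            c₁ (bxor (Fin.append u (p a u)) (Fin.append (fun _ : Fin 6 => false) (q a)))))) = 0 := by
      by_cases hqa : ∃ k, q a k = true
      · exact sum_ind_eq_zero_of_deg_five
          (te_isDegLeFun_band (isDegLeFun_apply i₀ le_rfl) (te_isDegLeFun_band (hgb a hqa) hR))
      · -- `q_a = 0`: the derivative `R_a` vanishes identically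
        have hq0 : Fin.append (fun _ : Fin 6 => false) (q a) = fun _ => false := by
          funext j
          induction j using Fin.addCases with
          | left i => exact Fin.append_left _ _ i
          | right k =>
            rw [Fin.append_right]
            cases hk : q a k
            · rfl
            · exact absurd ⟨k, hk⟩ hqa
        refine sum_eq_zero fun u _ => ?_
        rw [hq0, bxor_zero_right, Bool.xor_self, Bool.and_false, Bool.and_false, ind_false]
    rw [s1, s2, s3, add_zero, add_zero]
  -- (iii) the key identity says (i) + Σ_a (ii) = 0
  have h3 := key_identity i₀ δ γ hγq hγδ B hB c₂ h₂
  rw [sum_add_distrib, h1, sum_comm, sum_eq_zero (fun a _ => h2 a), add_zero] at h3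
  exact one_ne_zero h3

/-- **THEOREM ON for the cubes N1/N2.** Census normal form: base `u ↦ u` with
`u_{i₀} ← u_{i₀} ⊕ g(u)`, `g` quadratic and independent of `u_{i₀}`; sections
`t_a(u) = p_a(u) ⊕ γ_{i₀}(u)·q_a` (`q_a = E e_a`); TS-consequence `q_a ≠ 0 → deg(g·∂_{i₀}B_a) ≤ 2`.
EMPTY for every `r`. [folklore] -/
theorem oneSided_cubeN_empty (i₀ : Fin 6) (g : (Fin 6 → Bool) → Bool) (hg : IsDegLeFun 2 g)
    (hg0 : ∀ u b, g (Function.update u i₀ b) = g u)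
    (B : Fin r → (Fin 6 → Bool) → Bool) (hB : ∀ k, IsDegLeFun 2 (B k))
    (c₁ c₂ : (Fin (6 + r) → Bool) → Bool) (h₁ : IsDegLeFun 3 c₁) (h₂ : IsDegLeFun 3 c₂)
    (p : Fin r → (Fin 6 → Bool) → Fin r → Bool) (hp : ∀ a k, IsDegLeFun 1 (fun u => p a u k))
    (q : Fin r → Fin r → Bool)
    (hgb : ∀ a, (∃ k, q a k = true) → IsDegLeFun 2 (fun u : Fin 6 → Bool =>
      g u && (B a (Function.update u i₀ true) ^^ B a (Function.update u i₀ false))))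
    (h0 : ∀ u, (c₁ (Fin.append u (fun _ => false)) ^^
      c₂ (Fin.append (Function.update u i₀ (u i₀ ^^ g u)) (fun k => B k u))) =
        decide (∀ i, u i = false))
    (hsec : ∀ a u, (c₁ (Fin.append u (fun k => p a u k ^^ ((u i₀ ^^ g u) && q a k))) ^^
      c₂ (Fin.append (Function.update u i₀ (u i₀ ^^ g u)) (fun k => decide (k = a) ^^ B k u))) =
        decide (∀ i, u i = false)) :
    False := by
  refine oneSided_frameN_empty i₀ (fun i => decide (i = i₀))
    (fun u => Function.update u i₀ (u i₀ ^^ g u)) ?_ ?_ (fun u => u i₀ ^^ g u) ?_ B hB c₁ c₂ h₁ h₂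
    p hp q ?_ h0 hsec
  · intro i
    by_cases hi : i = i₀
    · subst hi
      have e : (fun u : Fin 6 → Bool => Function.update u i (u i ^^ g u) i) = fun u => u i ^^ g u :=
        funext fun u => Function.update_self i _ u
      rw [e]
      exact fc_deg_bxor (isDegLeFun_apply i (by norm_num)) hg
    · have e : (fun u : Fin 6 → Bool => Function.update u i₀ (u i₀ ^^ g u) i) = fun u => u i :=
        funext fun u => Function.update_of_ne hi _ u
      rw [e]
      exact isDegLeFun_apply i (by norm_num)
  · intro u
    funext i
    rw [hg0, hg0]
    by_cases hi : i = i₀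
    · subst hi; simp [bxor]
    · simp [bxor, hi]
  · intro u
    rw [Function.update_self, Function.update_self, hg0, hg0]
    cases g u <;> rfl
  · intro a hqa
    have e : (fun u : Fin 6 → Bool =>
        (Function.update u i₀ false i₀ ^^ g (Function.update u i₀ false)) &&
        (B a (Function.update u i₀ true) ^^ B a (Function.update u i₀ false))) =
        fun u => g u && (B a (Function.update u i₀ true) ^^ B a (Function.update u i₀ false)) := by
      funext u; rw [Function.update_self, hg0, Bool.false_xor]
    rw [e]
    exact hgb a hqa

end Summit.QuantumAdvantage.QuantumAdvantage.Theorems.NearExactIsExact.Negative.OneSidedFrameN
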